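import Summits.CriticalPhenomena.SAWScalingLimit.Theorems.CriticalBubbleBound.Negative.CriticalBubbleBoundLatticeKernel
import Literature.Probability.RandomPlanarGeometry.SAWCount
import Literature.Probability.RandomPlanarGeometry.SupercriticalSAWPolygons

/-!
# Objects of the line `docking-census-joining` for the crux `SAWTotalPositivity.CriticalBubbleBound`
(stmt-CriticalPhenomena-7117; lead prover, crux protocol; skeleton
`Summits/CriticalPhenomena/SAWScalingLimit/Cruxes/CriticalBubbleBound/Lines/docking-census-joining.lean`)

By the landed normal form (`Negative.criticalBubbleBound_iff_bubble_e₀_ne_top`,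
`Negative.latticeKernel_zero_eq_tsum_countAt`) the crux is the finiteness of ONE series
`Σ_n t_n`, `t_n := c_n(0,e₀) · x_c^n` (ROOTED critical polygon mass: an `n`-step SAW `0 → e₀` plus
the root edge `{0,e₀}` is a polygon through a marked horizontal edge). This file only DEFINES the
finite combinatorial objects the line's stubs speak about — no statement of the line is asserted here:

* `term`, `block`, `blockMass` — the terms `t_n`, the dyadic blocks `B_i = [2^i, 2^{i+1})` and block sums;
* `verts`, `pedges`, `rootEdge`, `shift` — vertex/edge sets of the rooted polygon of `ω ∈ Zd.sawFun 2 n e₀`;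
* `dockings j k ω ω'` — translations `v` placing the root edge `{v, v+e₀}` of the partner polygon `P(ω')+v`
  across a unit square from a NON-ROOT horizontal edge of `P(ω)`, with `P(ω)`, `P(ω')+v` vertex-disjoint
  (the two-parameter joining family of the idea card restricted to plaquette contacts at the partner's root);
* `pinches i n χ` — MACROSCOPIC PINCH PLAQUETTES of the rooted polygon of `χ`: unit squares whose two
  vertical sides are edges of `P(χ)`, whose horizontal sides are not, and whose flip splits `P(χ)` into two
  vertex-disjoint polygons, the one through the root edge and the other, both with `≥ 2^i + 1` edges;
* `dockMass i`, `pinchMass i` — the corresponding `x_c`-masses over dyadic blocks.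

Sources: N. Madras, G. Slade, *The Self-Avoiding Walk* (1993), §1.4 (the series), Def. 3.2.1 (polygons);
A. Hammond, *An upper bound on the number of self-avoiding polygons via joining*, Ann. Probab. 46 (2018)
(arXiv:1808.09032), §4.1 (join plaquettes; the plaquette flip). Deliberately NOT here: the line's two
open exponent statements (docking entropy, pinch rarity) and any theorem — they live in the stub files.
-/

noncomputable section

open Literature.Probability.LatticeModels
open Literature.Probability.RandomPlanarGeometry Literature.Probability.RandomPlanarGeometry.SAW
open scoped BigOperators
open Summit.CriticalPhenomena.SAWScalingLimit.Theorems.CriticalBubbleBound.Negative (e₀)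

namespace Summit.CriticalPhenomena.SAWScalingLimit.Theorems.CriticalBubbleBound.Docking

/-! ## Rooted critical terms and dyadic blocks -/

/-- The vertical unit vector `(0,1)` of `ℤ²` (`e₀ = (1,0)` is `Negative.e₀`). [folklore] -/
def e₁ : Site 2 := ![0, 1]

/-- The `n`-th term of the bubble series: `t_n = c_n(0,e₀) · x_c^n` (rooted critical polygon mass at
length `n`; only odd `n ≥ 1` contribute). [cite: MadrasSlade1993, §1.4] -/
def term (n : ℕ) : ℝ := (Zd.countAt 2 n e₀ : ℝ) * criticalFugacity ^ n

/-- The dyadic block `B_i = [2^i, 2^{i+1})` of lengths. [folklore] -/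
def block (i : ℕ) : Finset ℕ := Finset.Ico (2 ^ i) (2 ^ (i + 1))

/-- Block mass `R_i(t) = Σ_{n ∈ B_i} t_n` of a real sequence `t`. [folklore] -/
def blockMass (t : ℕ → ℝ) (i : ℕ) : ℝ := ∑ n ∈ block i, t n

/-! ## Rooted polygons of `ω ∈ Zd.sawFun 2 n e₀`: vertices, edges, root, translation -/

/-- Vertex set `{ω 0, …, ω n}` of (the first `n+1` values of) `ω`. [folklore] -/
def verts (n : ℕ) (ω : ℕ → Site 2) : Finset (Site 2) := (Finset.range (n + 1)).image ω

/-- Edge set of the ROOTED POLYGON of `ω ∈ sawFun 2 n e₀`: its `n` steps `{ω i, ω (i+1)}` plus the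
root edge `{ω n, ω 0} = {e₀, 0}` (Madras–Slade Def. 3.2.1: an `(N-1)`-step SAW with adjacent
endpoints together with the closing bond). [cite: MadrasSlade1993, Definition 3.2.1] -/
def pedges (n : ℕ) (ω : ℕ → Site 2) : Finset (Sym2 (Site 2)) :=
  insert s(ω n, ω 0) ((Finset.range n).image fun i => s(ω i, ω (i + 1)))

/-- The root edge `{0, e₀}`. [folklore] -/
def rootEdge : Sym2 (Site 2) := s((0 : Site 2), e₀)

/-- Translation of a vertex function by `v`. [folklore] -/
def shift (v : Site 2) (ω : ℕ → Site 2) : ℕ → Site 2 := fun i => ω i + v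

/-! ## Dockings and macroscopic pinch plaquettes -/

open Classical in
/-- DOCKINGS of the rooted polygon of `ω'` (size `k`) against the rooted polygon of `ω` (size `j`):
the translations `v` such that `P(ω')+v` is vertex-disjoint from `P(ω)` and the root edge `{v, v+e₀}`
of `P(ω')+v` lies across a unit square (below or above) from a horizontal NON-ROOT edge of `P(ω)` —
so that the join is a single plaquette flip (delete the two horizontal edges, add the two vertical
rungs) and the partner's root pays for the translation parameter. The idea card's two-parameter
family `Cont`, restricted to parallel plaquette contacts at the partner's root (Hammond's join
plaquettes, §4.1, docked anywhere along `P(ω)` rather than in one column).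
[cite: MadrasSlade1993, Definition 3.2.1] -/
def dockings (j k : ℕ) (ω ω' : ℕ → Site 2) : Finset (Site 2) :=
  ((verts j ω).image (· + e₁) ∪ (verts j ω).image (· - e₁)).filter fun v =>
    Disjoint (verts j ω) (verts k (shift v ω')) ∧
      ((s(v - e₁, v + e₀ - e₁) ∈ pedges j ω ∧ s(v - e₁, v + e₀ - e₁) ≠ rootEdge) ∨
        (s(v + e₁, v + e₀ + e₁) ∈ pedges j ω ∧ s(v + e₁, v + e₀ + e₁) ≠ rootEdge))

open Classical in
/-- MACROSCOPIC PINCH PLAQUETTES of the rooted polygon of `χ` (size `n`) at scale `i`: lower-left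
corners `q` (vertices of `χ`) of unit squares whose two vertical sides are edges of `P(χ)`, whose two
horizontal sides are not, and whose flip (remove the vertical sides, add the horizontal ones) splits
`P(χ)` into two vertex-disjoint polygons `E₁ ∋ rootEdge` and `E₂`, BOTH with at least `2^i + 1` edges.
(Ungraded pinches — unit bumps — have positive density by Kesten's pattern theorem; only the
macroscopic ones can be rare.) [cite: MadrasSlade1993, Definition 3.2.1] -/
def pinches (i n : ℕ) (χ : ℕ → Site 2) : Finset (Site 2) :=
  (verts n χ).filter fun q =>
    s(q, q + e₁) ∈ pedges n χ ∧ s(q + e₀, q + e₀ + e₁) ∈ pedges n χ ∧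
    s(q, q + e₀) ∉ pedges n χ ∧ s(q + e₁, q + e₀ + e₁) ∉ pedges n χ ∧
    ∃ E₁ E₂ : Finset (Sym2 (Site 2)),
      IsPolygon (zdGraph 2) E₁ ∧ IsPolygon (zdGraph 2) E₂ ∧
      (∀ x : Site 2, (∃ e ∈ E₁, x ∈ e) → (∃ e ∈ E₂, x ∈ e) → False) ∧
      E₁ ∪ E₂ = insert s(q, q + e₀) (insert s(q + e₁, q + e₀ + e₁)
        (((pedges n χ).erase s(q, q + e₁)).erase s(q + e₀, q + e₀ + e₁))) ∧
      rootEdge ∈ E₁ ∧ 2 ^ i + 1 ≤ E₁.card ∧ 2 ^ i + 1 ≤ E₂.card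

/-- DOCKING MASS at scale `i`: `Σ_{j,k ∈ B_i} Σ_{ω,ω'} |dockings j k ω ω'| · x_c^j x_c^k` (a finite sum).
[cite: MadrasSlade1993, §1.4] -/
def dockMass (i : ℕ) : ℝ :=
  ∑ j ∈ block i, ∑ k ∈ block i, ∑ ω ∈ Zd.sawFun 2 j e₀, ∑ ω' ∈ Zd.sawFun 2 k e₀,
    ((dockings j k ω ω').card : ℝ) * (criticalFugacity ^ j * criticalFugacity ^ k)

/-- PINCH MASS at scale `i`: `Σ_{n ∈ B_{i+1}} Σ_{χ} |pinches i n χ| · x_c^n` (a finite sum).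
[cite: MadrasSlade1993, §1.4] -/
def pinchMass (i : ℕ) : ℝ :=
  ∑ n ∈ block (i + 1), ∑ χ ∈ Zd.sawFun 2 n e₀, ((pinches i n χ).card : ℝ) * criticalFugacity ^ n

/-! ## Elementary API -/

/-- The terms of the bubble series are nonnegative. [folklore] -/
theorem term_nonneg (n : ℕ) : 0 ≤ term n :=
  mul_nonneg (Nat.cast_nonneg _) (pow_nonneg criticalFugacity_pos_lt_one'.1.le n)

/-- Block masses of a nonnegative sequence are nonnegative. [folklore] -/
theorem blockMass_nonneg {t : ℕ → ℝ} (ht : ∀ n, 0 ≤ t n) (i : ℕ) : 0 ≤ blockMass t i :=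
  Finset.sum_nonneg fun n _ => ht n

/-- Unfolding lemma: `blockMass t i` is the sum of `t` over `Finset.Ico (2^i) (2^(i+1))`. [folklore] -/
theorem blockMass_eq (t : ℕ → ℝ) (i : ℕ) :
    blockMass t i = ∑ n ∈ Finset.Ico (2 ^ i) (2 ^ (i + 1)), t n := rfl

/-- Every `n ≥ 1` lies in the dyadic block `B_{log₂ n}`. [folklore] -/
theorem mem_block_log {n : ℕ} (hn : n ≠ 0) : n ∈ block (Nat.log 2 n) := by
  rw [block, Finset.mem_Ico]
  exact ⟨Nat.pow_log_le_self 2 hn, Nat.lt_pow_succ_log_self (by norm_num) n⟩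

/-- Docking masses are nonnegative (registered infrastructure sub-goal of the line, carried by this
shared definitions file). [folklore] -/
theorem dockMass_nonneg : ∀ i : ℕ, 0 ≤ dockMass i := by
  intro i
  refine Finset.sum_nonneg fun j _ => Finset.sum_nonneg fun k _ =>
    Finset.sum_nonneg fun ω _ => Finset.sum_nonneg fun ω' _ => ?_
  have hx := criticalFugacity_pos_lt_one'.1.le
  exact mul_nonneg (Nat.cast_nonneg _) (mul_nonneg (pow_nonneg hx j) (pow_nonneg hx k))

/-- Pinch masses are nonnegative. [folklore] -/
theorem pinchMass_nonneg (i : ℕ) : 0 ≤ pinchMass i := by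
  refine Finset.sum_nonneg fun n _ => Finset.sum_nonneg fun χ _ => ?_
  exact mul_nonneg (Nat.cast_nonneg _) (pow_nonneg criticalFugacity_pos_lt_one'.1.le n)

end Summit.CriticalPhenomena.SAWScalingLimit.Theorems.CriticalBubbleBound.Docking

end
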